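import Literature.IUT.LogVolume.LatticeAutOrbits
import Mathlib.LinearAlgebra.PiTensorProduct.Basis
import HarnessLib

/-!
# The `ℤ`-span of the FACTORWISE lattice automorphisms `⊗_i Aut(L_{b_i})` is all of `End`: the orbit-span lower bound
# for tensor lattices without transitivity (Weil, *Basic Number Theory* Ch. II §2 Th. 1; [IUTchIII] Thm. 3.11 (i) (Ind2))

Lattice-level half of `TensorPacketFactorwiseOrbitSpan.lean` (the packet-level consumer). `LatticeAutOrbits.lean` proves
that the orbit of a primitive vector under the FULL group `Aut_{ℚ_p}(W : L_b)` additively generates `L_b`, by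
TRANSITIVITY on primitive vectors. For a tensor lattice `L_B`, `B = ⊗_i b_i`, [IUTchIII] Thm. 3.11 (i) (Ind2) only lets
"independent copies of Ism act on each of the … factors", i.e. the factorwise maps `⊗_i g_i`, `g_i ∈ Aut(L_{b_i})` — a
subgroup that is not transitive on primitive vectors. The additive conclusion survives, because the `ℤ`-SPAN of the
factorwise maps is already `⊗_i End_{ℤ_p}(L_{b_i}) = End_{ℤ_p}(L_B)` on the relevant generators:

* `rankOne_mem_closure_latticeAut`: every rank-one map `t·E_{j'j} : w ↦ w_j·t·b_{j'}` (`‖t‖ ≤ 1`) of ONE space is a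
  `ℤ`-combination of lattice automorphisms of `L_b` — off the diagonal a transvection minus `1`
  (`exists_latticeAut_coe_eq_transvection`), on the diagonal `(1 + t·E_{jj''})(1 + E_{j''j}) − 1 − t·E_{jj''} − E_{j''j}`,
  or a unit scaling (`exists_latticeAut_coe_eq_smul_id`, `smul_id_mem_closure_latticeAut`) when `b` has one element;
* `map_mem_closure_congr`: `⊗_i f_i` is a `ℤ`-combination of the `⊗_i g_i` as soon as each `f_i` is one of the `g_i`'s
  (`PiTensorProduct.map` is additive in each slot, `PiTensorProduct.map_update_add`; induction on the slots);
* `map_rankOne_apply`: `(⊗_i t_i·E^{(i)}_{κ'_i κ₀_i})(x) = (∏_i t_i)·x_{κ₀}·B_{κ'}`;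
* **`smul_basisLattice_subset_closure_factorwiseOrbit`**: hence if a set `M ∋ c·x₀` where `x₀` has a UNIT
  `B`-coordinate, then `c·L_B ⊆ closure(⋃_g (⊗_i g_i)(M))` over the factorwise families of lattice automorphisms.

[cite: WeilBNT1967, Ch. II §2, Th. 1] [cite: Mochizuki2012, IUTchIII Thm. 3.11 (i) (Ind2) p. 154] Nothing here is about
volumes, hulls or [IUTchIII] Cor. 3.12; the group shapes are the tree's `latticeAut` / `PiTensorProduct.congr`.
PROOF-ONLY file: no new definitions, no named `Prop` facts.
-/

noncomputable section

open Set Module Function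
open scoped Pointwise TensorProduct

namespace Literature.IUT.LogVolume

namespace PadicModule

variable (p : ℕ) [Fact p.Prime]

section Single

variable {W : Type*} [AddCommGroup W] [Module ℚ_[p] W] {ι : Type*} [Fintype ι]

/-- The coercion of a lattice automorphism lies in the additive closure of the coercions. [folklore] -/
private theorem coe_mem_closure_latticeAut (b : Basis ι ℚ_[p] W) {φ : W ≃ₗ[ℚ_[p]] W}
    (hφ : φ ∈ latticeAut ℚ_[p] (basisLattice p b).toIntSubmodule) :
    (φ : W →ₗ[ℚ_[p]] W) ∈ AddSubgroup.closure ((fun ψ : W ≃ₗ[ℚ_[p]] W => (ψ : W →ₗ[ℚ_[p]] W)) ''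
      (latticeAut ℚ_[p] (basisLattice p b).toIntSubmodule : Set (W ≃ₗ[ℚ_[p]] W))) :=
  AddSubgroup.subset_closure ⟨φ, hφ, rfl⟩

/-- The identity lies in that closure. [folklore] -/
private theorem id_mem_closure_latticeAut (b : Basis ι ℚ_[p] W) :
    (LinearMap.id : W →ₗ[ℚ_[p]] W) ∈ AddSubgroup.closure ((fun ψ : W ≃ₗ[ℚ_[p]] W => (ψ : W →ₗ[ℚ_[p]] W)) ''
      (latticeAut ℚ_[p] (basisLattice p b).toIntSubmodule : Set (W ≃ₗ[ℚ_[p]] W))) :=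
  coe_mem_closure_latticeAut p b (φ := LinearEquiv.refl ℚ_[p] W) (latticeAut ℚ_[p] _).one_mem

/-- **Unit scalings are lattice automorphisms**: for `‖u‖ = 1` the homothety `u·id` maps `L_b` onto itself; recorded
as: `u • id` is the coercion of a lattice automorphism. [cite: WeilBNT1967, Ch. II §2, Th. 1] -/
theorem exists_latticeAut_coe_eq_smul_id (b : Basis ι ℚ_[p] W) {u : ℚ_[p]} (hu : ‖u‖ = 1) :
    ∃ φ ∈ latticeAut ℚ_[p] (basisLattice p b).toIntSubmodule,
      (φ : W →ₗ[ℚ_[p]] W) = u • (LinearMap.id : W →ₗ[ℚ_[p]] W) := by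
  have hu0 : u ≠ 0 := norm_ne_zero_iff.mp (by rw [hu]; exact one_ne_zero)
  have h1 : (u • (LinearMap.id : W →ₗ[ℚ_[p]] W)).comp (u⁻¹ • LinearMap.id) = LinearMap.id := by
    ext w; simp [smul_smul, mul_inv_cancel₀ hu0]
  have h2 : (u⁻¹ • (LinearMap.id : W →ₗ[ℚ_[p]] W)).comp (u • LinearMap.id) = LinearMap.id := by
    ext w; simp [smul_smul, inv_mul_cancel₀ hu0]
  refine ⟨LinearEquiv.ofLinear _ _ h1 h2, ?_, rfl⟩
  refine mem_latticeAut_of_mapsTo _ (fun w hw => ?_) (fun w hw => ?_)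
  · change u • w ∈ basisLattice p b
    exact smul_mem_basisLattice p b hu.le hw
  · change u⁻¹ • w ∈ basisLattice p b
    exact smul_mem_basisLattice p b (by rw [norm_inv, hu, inv_one]) hw

/-- `t • id` is a `ℤ`-combination of lattice automorphisms for every `‖t‖ ≤ 1`: a unit scaling if `‖t‖ = 1`,
else `(t − 1)·id + id` with `‖t − 1‖ = 1` (ultrametric). [cite: WeilBNT1967, Ch. II §2, Th. 1] -/
theorem smul_id_mem_closure_latticeAut (b : Basis ι ℚ_[p] W) {t : ℚ_[p]} (ht : ‖t‖ ≤ 1) :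
    (t • (LinearMap.id : W →ₗ[ℚ_[p]] W)) ∈ AddSubgroup.closure ((fun ψ : W ≃ₗ[ℚ_[p]] W => (ψ : W →ₗ[ℚ_[p]] W)) ''
      (latticeAut ℚ_[p] (basisLattice p b).toIntSubmodule : Set (W ≃ₗ[ℚ_[p]] W))) := by
  rcases ht.eq_or_lt with h | h
  · obtain ⟨φ, hφ, hφe⟩ := exists_latticeAut_coe_eq_smul_id p b h
    rw [← hφe]
    exact coe_mem_closure_latticeAut p b hφ
  · have h1 : ‖t - 1‖ = 1 := by
      rw [sub_eq_add_neg, IsUltrametricDist.norm_add_eq_max_of_norm_ne_norm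
        (by rw [norm_neg, norm_one]; exact h.ne), norm_neg, norm_one, max_eq_right h.le]
    obtain ⟨φ, hφ, hφe⟩ := exists_latticeAut_coe_eq_smul_id p b h1
    have ht' : t • (LinearMap.id : W →ₗ[ℚ_[p]] W) = (t - 1) • LinearMap.id + LinearMap.id := by
      rw [sub_smul, one_smul, sub_add_cancel]
    rw [ht', ← hφe]
    exact add_mem (coe_mem_closure_latticeAut p b hφ) (id_mem_closure_latticeAut p b)

/-- **Transvections are lattice automorphisms**: for `j ≠ j'` and `‖t‖ ≤ 1`, `w ↦ w + w_j·t·b_{j'}` maps `L_b` onto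
itself (inverse `w ↦ w − w_j·t·b_{j'}`). [cite: WeilBNT1967, Ch. II §2, Th. 1] -/
theorem exists_latticeAut_coe_eq_transvection (b : Basis ι ℚ_[p] W) {j j' : ι} (hjj' : j ≠ j') {t : ℚ_[p]}
    (ht : ‖t‖ ≤ 1) :
    ∃ φ ∈ latticeAut ℚ_[p] (basisLattice p b).toIntSubmodule,
      (φ : W →ₗ[ℚ_[p]] W) = LinearMap.id + (b.coord j).smulRight (t • b j') := by
  classical
  have hjb : b.coord j (b j') = 0 := by
    rw [Basis.coord_apply, b.repr_self, Finsupp.single_eq_of_ne hjj']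
  set E : W →ₗ[ℚ_[p]] W := (b.coord j).smulRight (t • b j') with hE
  have hEa : ∀ w, E w = b.coord j w • (t • b j') := fun w => rfl
  have hEE : ∀ w, E (E w) = 0 := fun w => by
    simp only [hEa, map_smul, hjb, smul_eq_mul, mul_zero, zero_smul]
  have h1 : (LinearMap.id + E).comp (LinearMap.id - E) = LinearMap.id := by
    ext w
    simp only [LinearMap.comp_apply, LinearMap.sub_apply, LinearMap.id_apply, LinearMap.add_apply, map_sub, hEE]
    abel
  have h2 : (LinearMap.id - E).comp (LinearMap.id + E) = LinearMap.id := by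
    ext w
    simp only [LinearMap.comp_apply, LinearMap.sub_apply, LinearMap.id_apply, LinearMap.add_apply, map_add, hEE]
    abel
  have hmem : ∀ w ∈ basisLattice p b, E w ∈ basisLattice p b := fun w hw => by
    rw [hEa]
    exact smul_mem_basisLattice p b ((mem_basisLattice p b).mp hw j)
      (smul_mem_basisLattice p b ht (basis_mem_basisLattice p b j'))
  refine ⟨LinearEquiv.ofLinear _ _ h1 h2, ?_, rfl⟩
  refine mem_latticeAut_of_mapsTo _ (fun w hw => ?_) (fun w hw => ?_)
  · change w + E w ∈ basisLattice p b
    exact add_mem hw (hmem w hw)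
  · change w - E w ∈ basisLattice p b
    exact sub_mem hw (hmem w hw)

/-- For `j ≠ j'` the rank-one map `t·E_{j'j} : w ↦ w_j·t·b_{j'}` (`‖t‖ ≤ 1`) is a transvection minus the identity,
hence a `ℤ`-combination of lattice automorphisms. [cite: WeilBNT1967, Ch. II §2, Th. 1] -/
theorem rankOne_mem_closure_latticeAut_of_ne (b : Basis ι ℚ_[p] W) {j j' : ι} (hjj' : j ≠ j') {t : ℚ_[p]}
    (ht : ‖t‖ ≤ 1) :
    ((b.coord j).smulRight (t • b j') : W →ₗ[ℚ_[p]] W) ∈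
      AddSubgroup.closure ((fun ψ : W ≃ₗ[ℚ_[p]] W => (ψ : W →ₗ[ℚ_[p]] W)) ''
        (latticeAut ℚ_[p] (basisLattice p b).toIntSubmodule : Set (W ≃ₗ[ℚ_[p]] W))) := by
  obtain ⟨φ, hφ, hφe⟩ := exists_latticeAut_coe_eq_transvection p b hjj' ht
  have h : ((b.coord j).smulRight (t • b j') : W →ₗ[ℚ_[p]] W) = (φ : W →ₗ[ℚ_[p]] W) - LinearMap.id := by
    rw [hφe, add_sub_cancel_left]
  rw [h]
  exact sub_mem (coe_mem_closure_latticeAut p b hφ) (id_mem_closure_latticeAut p b)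

/-- **`span_ℤ Aut(L_b) ⊇` the elementary maps**: EVERY rank-one map `t·E_{j'j} : w ↦ w_j·t·b_{j'}` with `‖t‖ ≤ 1`
is a `ℤ`-combination of lattice automorphisms of `L_b` — off the diagonal a transvection minus `1`; on the diagonal
`t·E_{jj} = (1 + t·E_{jj''})(1 + E_{j''j}) − 1 − t·E_{jj''} − E_{j''j}` for any `j'' ≠ j`, and `t·E_{jj} = t·id` when
`b` has one element. [cite: WeilBNT1967, Ch. II §2, Th. 1] -/
theorem rankOne_mem_closure_latticeAut (b : Basis ι ℚ_[p] W) (j j' : ι) {t : ℚ_[p]} (ht : ‖t‖ ≤ 1) :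
    ((b.coord j).smulRight (t • b j') : W →ₗ[ℚ_[p]] W) ∈
      AddSubgroup.closure ((fun ψ : W ≃ₗ[ℚ_[p]] W => (ψ : W →ₗ[ℚ_[p]] W)) ''
        (latticeAut ℚ_[p] (basisLattice p b).toIntSubmodule : Set (W ≃ₗ[ℚ_[p]] W))) := by
  by_cases hjj' : j ≠ j'
  · exact rankOne_mem_closure_latticeAut_of_ne p b hjj' ht
  rw [not_ne_iff] at hjj'
  subst hjj'
  by_cases h2 : ∃ j'', j'' ≠ j
  · obtain ⟨j'', hj''⟩ := h2
    -- `(1 + t E_{j j''}) (1 + E_{j'' j}) = 1 + E_{j''j} + t E_{jj''} + t E_{jj}`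
    obtain ⟨φ₁, hφ₁, hφ₁e⟩ := exists_latticeAut_coe_eq_transvection p b hj'' ht
    obtain ⟨φ₂, hφ₂, hφ₂e⟩ := exists_latticeAut_coe_eq_transvection p b hj''.symm (t := 1) (by rw [norm_one])
    have hc1 : b.coord j'' (b j'') = 1 := by rw [Basis.coord_apply, b.repr_self, Finsupp.single_eq_same]
    have key : ((b.coord j).smulRight (t • b j) : W →ₗ[ℚ_[p]] W) =
        ((φ₁ * φ₂ : W ≃ₗ[ℚ_[p]] W) : W →ₗ[ℚ_[p]] W) - LinearMap.id - (b.coord j).smulRight ((1 : ℚ_[p]) • b j'') -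
          (b.coord j'').smulRight (t • b j) := by
      have hmul : ((φ₁ * φ₂ : W ≃ₗ[ℚ_[p]] W) : W →ₗ[ℚ_[p]] W) = (φ₁ : W →ₗ[ℚ_[p]] W).comp (φ₂ : W →ₗ[ℚ_[p]] W) := rfl
      rw [hmul, hφ₁e, hφ₂e]
      ext w
      simp only [LinearMap.sub_apply, LinearMap.comp_apply, LinearMap.add_apply, LinearMap.id_apply,
        LinearMap.smulRight_apply, map_add, map_smul, hc1, one_smul]
      module
    rw [key]
    exact sub_mem (sub_mem (sub_mem (coe_mem_closure_latticeAut p b ((latticeAut ℚ_[p] _).mul_mem hφ₁ hφ₂))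
      (id_mem_closure_latticeAut p b)) (rankOne_mem_closure_latticeAut_of_ne p b hj''.symm (by rw [norm_one])))
      (rankOne_mem_closure_latticeAut_of_ne p b hj'' ht)
  · -- one-element basis: `E_{jj} = id`
    push Not at h2
    have key : ((b.coord j).smulRight (t • b j) : W →ₗ[ℚ_[p]] W) = t • LinearMap.id := by
      refine b.ext fun m => ?_
      rw [h2 m, LinearMap.smulRight_apply, Basis.coord_apply, b.repr_self, Finsupp.single_eq_same, one_smul,
        LinearMap.smul_apply, LinearMap.id_apply]
    rw [key]
    exact smul_id_mem_closure_latticeAut p b ht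

end Single

section Tensor

variable {I : Type} [Fintype I] [DecidableEq I] {V : I → Type*} [∀ i, AddCommGroup (V i)] [∀ i, Module ℚ_[p] (V i)]
  {κ : I → Type*} [∀ i, Fintype (κ i)]

/-- **Multi-additivity**: if every `f_i` is a `ℤ`-combination of lattice automorphisms of `L_{b_i}`, then `⊗_i f_i`
is a `ℤ`-combination of the factorwise maps `⊗_i g_i`, `g_i ∈ Aut(L_{b_i})` (`PiTensorProduct.map` is additive in
each slot, `PiTensorProduct.map_update_add`; induction on the slots). [cite: WeilBNT1967, Ch. II §2, Th. 1] -/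
theorem map_mem_closure_congr (b : ∀ i, Basis (κ i) ℚ_[p] (V i)) (f : ∀ i, V i →ₗ[ℚ_[p]] V i)
    (hf : ∀ i, f i ∈ AddSubgroup.closure ((fun ψ : V i ≃ₗ[ℚ_[p]] V i => (ψ : V i →ₗ[ℚ_[p]] V i)) ''
      (latticeAut ℚ_[p] (basisLattice p (b i)).toIntSubmodule : Set (V i ≃ₗ[ℚ_[p]] V i)))) :
    PiTensorProduct.map f ∈ AddSubgroup.closure
      ((fun g : (∀ i, V i ≃ₗ[ℚ_[p]] V i) =>
          ((PiTensorProduct.congr g : (⨂[ℚ_[p]] i, V i) ≃ₗ[ℚ_[p]] ⨂[ℚ_[p]] i, V i) :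
            (⨂[ℚ_[p]] i, V i) →ₗ[ℚ_[p]] ⨂[ℚ_[p]] i, V i)) ''
        {g | ∀ i, g i ∈ latticeAut ℚ_[p] (basisLattice p (b i)).toIntSubmodule}) := by
  suffices h : ∀ (s : Finset I) (f : ∀ i, V i →ₗ[ℚ_[p]] V i),
      (∀ i ∈ s, f i ∈ AddSubgroup.closure ((fun ψ : V i ≃ₗ[ℚ_[p]] V i => (ψ : V i →ₗ[ℚ_[p]] V i)) ''
        (latticeAut ℚ_[p] (basisLattice p (b i)).toIntSubmodule : Set (V i ≃ₗ[ℚ_[p]] V i)))) →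
      (∀ i ∉ s, ∃ g ∈ latticeAut ℚ_[p] (basisLattice p (b i)).toIntSubmodule, f i = (g : V i →ₗ[ℚ_[p]] V i)) →
      PiTensorProduct.map f ∈ AddSubgroup.closure
        ((fun g : (∀ i, V i ≃ₗ[ℚ_[p]] V i) =>
            ((PiTensorProduct.congr g : (⨂[ℚ_[p]] i, V i) ≃ₗ[ℚ_[p]] ⨂[ℚ_[p]] i, V i) :
              (⨂[ℚ_[p]] i, V i) →ₗ[ℚ_[p]] ⨂[ℚ_[p]] i, V i)) ''
          {g | ∀ i, g i ∈ latticeAut ℚ_[p] (basisLattice p (b i)).toIntSubmodule}) from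
    h Finset.univ f (fun i _ => hf i) (fun i hi => absurd (Finset.mem_univ i) hi)
  intro s
  induction s using Finset.induction_on with
  | empty =>
    intro f _ h2
    choose g hg hfg using fun i => h2 i (Finset.notMem_empty i)
    have hf' : f = fun i => ((g i : V i ≃ₗ[ℚ_[p]] V i) : V i →ₗ[ℚ_[p]] V i) := funext hfg
    refine AddSubgroup.subset_closure ⟨g, hg, ?_⟩
    rw [hf']
    rfl
  | @insert a s ha IH =>
    intro f h1 h2
    let Φ : (V a →ₗ[ℚ_[p]] V a) →+ ((⨂[ℚ_[p]] i, V i) →ₗ[ℚ_[p]] ⨂[ℚ_[p]] i, V i) :=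
      { toFun := fun u => PiTensorProduct.map (update f a u)
        map_zero' := by
          have h := PiTensorProduct.map_update_smul f a (0 : ℚ_[p]) (0 : V a →ₗ[ℚ_[p]] V a)
          rwa [zero_smul, zero_smul] at h
        map_add' := fun u v => PiTensorProduct.map_update_add f a u v }
    have hΦ : ∀ u, Φ u = PiTensorProduct.map (update f a u) := fun u => rfl
    have hle : AddSubgroup.closure ((fun ψ : V a ≃ₗ[ℚ_[p]] V a => (ψ : V a →ₗ[ℚ_[p]] V a)) ''
        (latticeAut ℚ_[p] (basisLattice p (b a)).toIntSubmodule : Set (V a ≃ₗ[ℚ_[p]] V a))) ≤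
        (AddSubgroup.closure
          ((fun g : (∀ i, V i ≃ₗ[ℚ_[p]] V i) =>
              ((PiTensorProduct.congr g : (⨂[ℚ_[p]] i, V i) ≃ₗ[ℚ_[p]] ⨂[ℚ_[p]] i, V i) :
                (⨂[ℚ_[p]] i, V i) →ₗ[ℚ_[p]] ⨂[ℚ_[p]] i, V i)) ''
            {g | ∀ i, g i ∈ latticeAut ℚ_[p] (basisLattice p (b i)).toIntSubmodule})).comap Φ := by
      rw [AddSubgroup.closure_le]
      rintro _ ⟨g, hg, rfl⟩
      rw [SetLike.mem_coe, AddSubgroup.mem_comap, hΦ]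
      refine IH (update f a g) (fun i hi => ?_) (fun i hi => ?_)
      · have hia : i ≠ a := fun h => ha (h ▸ hi)
        rw [update_of_ne hia]
        exact h1 i (Finset.mem_insert_of_mem hi)
      · by_cases hia : i = a
        · subst hia
          exact ⟨g, hg, update_self i _ f⟩
        · rw [update_of_ne hia]
          exact h2 i (by rw [Finset.mem_insert]; push Not; exact ⟨hia, hi⟩)
    have hfa := hle (h1 a (Finset.mem_insert_self a s))
    rw [AddSubgroup.mem_comap, hΦ, update_eq_self] at hfa
    exact hfa

omit [DecidableEq I] [∀ i, Fintype (κ i)] in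
/-- **Evaluation of a tensor of rank-one maps**: in the tensor basis `B = ⊗_i b_i`,
`(⊗_i t_i·E^{(i)}_{κ'_i κ₀_i})(x) = (∏_i t_i)·x_{κ₀}·B_{κ'}`. [folklore] -/
private theorem map_rankOne_apply [∀ i, DecidableEq (κ i)] (b : ∀ i, Basis (κ i) ℚ_[p] (V i)) (κ₀ κ' : ∀ i, κ i)
    (t : I → ℚ_[p]) (x : ⨂[ℚ_[p]] i, V i) :
    PiTensorProduct.map (fun i => ((b i).coord (κ₀ i)).smulRight (t i • b i (κ' i))) x =
      ((∏ i, t i) * (Basis.piTensorProduct b).repr x κ₀) • Basis.piTensorProduct b κ' := by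
  suffices h : PiTensorProduct.map (fun i => ((b i).coord (κ₀ i)).smulRight (t i • b i (κ' i))) =
      ((Basis.piTensorProduct b).coord κ₀).smulRight ((∏ i, t i) • Basis.piTensorProduct b κ') by
    rw [h, LinearMap.smulRight_apply, Basis.coord_apply, smul_smul, mul_comm]
  refine (Basis.piTensorProduct b).ext fun κ₁ => ?_
  rw [LinearMap.smulRight_apply, Basis.coord_apply, Basis.repr_self, Basis.piTensorProduct_apply,
    PiTensorProduct.map_tprod]
  simp only [LinearMap.smulRight_apply, Basis.coord_apply, Basis.repr_self]
  by_cases hκ : κ₁ = κ₀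
  · subst hκ
    simp only [Finsupp.single_eq_same, one_smul]
    rw [MultilinearMap.map_smul_univ (PiTensorProduct.tprod ℚ_[p]) t (fun i => b i (κ' i)),
      ← Basis.piTensorProduct_apply]
  · obtain ⟨i, hi⟩ : ∃ i, κ₁ i ≠ κ₀ i := by
      by_contra h
      push Not at h
      exact hκ (funext h)
    rw [Finsupp.single_eq_of_ne (Ne.symm hκ), zero_smul]
    exact (PiTensorProduct.tprod ℚ_[p]).map_coord_zero i (by rw [Finsupp.single_eq_of_ne (Ne.symm hi), zero_smul])

/-- **Hull lower bound, additive form, FACTORWISE group** (lattice level): if `M ∋ c·x₀` with `x₀` having a UNIT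
`B`-coordinate (`B = ⊗_i b_i`), then `c·L_B ⊆ closure(⋃_g (⊗_i g_i)(M))` over the families of lattice
automorphisms `g_i ∈ Aut_{ℚ_p}(V_i : L_{b_i})` — the `ℤ`-span of the factorwise orbit of ONE vector of content `c`
is `c·L_B` (`rankOne_mem_closure_latticeAut`, `map_mem_closure_congr`, `map_rankOne_apply`).
[cite: WeilBNT1967, Ch. II §2, Th. 1] [cite: Mochizuki2012, IUTchIII Thm. 3.11 (i) (Ind2) p. 154] -/
theorem smul_basisLattice_subset_closure_factorwiseOrbit [Nonempty I] [∀ i, DecidableEq (κ i)]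
    (b : ∀ i, Basis (κ i) ℚ_[p] (V i)) {M : Set (⨂[ℚ_[p]] i, V i)} {x₀ : ⨂[ℚ_[p]] i, V i} {κ₀ : ∀ i, κ i}
    (hκ₀ : ‖(Basis.piTensorProduct b).repr x₀ κ₀‖ = 1) {c : ℚ_[p]} (hxM : c • x₀ ∈ M) :
    c • (basisLattice p (Basis.piTensorProduct b) : Set (⨂[ℚ_[p]] i, V i)) ⊆
      AddSubgroup.closure (⋃ g ∈ {g : ∀ i, V i ≃ₗ[ℚ_[p]] V i |
          ∀ i, g i ∈ latticeAut ℚ_[p] (basisLattice p (b i)).toIntSubmodule},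
        (PiTensorProduct.congr g : (⨂[ℚ_[p]] i, V i) ≃ₗ[ℚ_[p]] ⨂[ℚ_[p]] i, V i) '' M) := by
  -- (A) every `ℤ`-combination `φ` of factorwise maps has `φ (c • x₀)` in the closure
  have hA : ∀ φ ∈ AddSubgroup.closure
      ((fun g : (∀ i, V i ≃ₗ[ℚ_[p]] V i) =>
          ((PiTensorProduct.congr g : (⨂[ℚ_[p]] i, V i) ≃ₗ[ℚ_[p]] ⨂[ℚ_[p]] i, V i) :
            (⨂[ℚ_[p]] i, V i) →ₗ[ℚ_[p]] ⨂[ℚ_[p]] i, V i)) ''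
        {g | ∀ i, g i ∈ latticeAut ℚ_[p] (basisLattice p (b i)).toIntSubmodule}),
      φ (c • x₀) ∈ AddSubgroup.closure (⋃ g ∈ {g : ∀ i, V i ≃ₗ[ℚ_[p]] V i |
          ∀ i, g i ∈ latticeAut ℚ_[p] (basisLattice p (b i)).toIntSubmodule},
        (PiTensorProduct.congr g : (⨂[ℚ_[p]] i, V i) ≃ₗ[ℚ_[p]] ⨂[ℚ_[p]] i, V i) '' M) := by
    intro φ hφ
    let ev : ((⨂[ℚ_[p]] i, V i) →ₗ[ℚ_[p]] ⨂[ℚ_[p]] i, V i) →+ ⨂[ℚ_[p]] i, V i :=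
      { toFun := fun ψ => ψ (c • x₀), map_zero' := rfl, map_add' := fun _ _ => rfl }
    have hev : ∀ ψ, ev ψ = ψ (c • x₀) := fun ψ => rfl
    rw [← hev, ← AddSubgroup.mem_comap]
    refine (AddSubgroup.closure_le _).mpr ?_ hφ
    rintro _ ⟨g, hg, rfl⟩
    rw [SetLike.mem_coe, AddSubgroup.mem_comap, hev]
    exact AddSubgroup.subset_closure (Set.mem_iUnion₂.mpr ⟨g, hg, Set.mem_image_of_mem _ hxM⟩)
  -- (B) every `(c * a) • B κ'`, `‖a‖ ≤ 1`, lies in the closure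
  have hd0 : (Basis.piTensorProduct b).repr x₀ κ₀ ≠ 0 := norm_ne_zero_iff.mp (by rw [hκ₀]; exact one_ne_zero)
  have hBmem : ∀ (κ' : ∀ i, κ i) (a : ℚ_[p]), ‖a‖ ≤ 1 →
      (c * a) • Basis.piTensorProduct b κ' ∈ AddSubgroup.closure (⋃ g ∈ {g : ∀ i, V i ≃ₗ[ℚ_[p]] V i |
          ∀ i, g i ∈ latticeAut ℚ_[p] (basisLattice p (b i)).toIntSubmodule},
        (PiTensorProduct.congr g : (⨂[ℚ_[p]] i, V i) ≃ₗ[ℚ_[p]] ⨂[ℚ_[p]] i, V i) '' M) := by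
    intro κ' a ha
    obtain ⟨i₀⟩ := ‹Nonempty I›
    let t : I → ℚ_[p] := update (fun _ => (1 : ℚ_[p])) i₀ (a * ((Basis.piTensorProduct b).repr x₀ κ₀)⁻¹)
    have ht : ∀ i, ‖t i‖ ≤ 1 := by
      intro i
      by_cases hi : i = i₀
      · subst hi
        show ‖update (fun _ => (1 : ℚ_[p])) i _ i‖ ≤ 1
        rw [update_self, norm_mul, norm_inv, hκ₀, inv_one, mul_one]
        exact ha
      · show ‖update (fun _ => (1 : ℚ_[p])) i₀ _ i‖ ≤ 1
        rw [update_of_ne hi, norm_one]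
    have hprod : (∏ i, t i) * (Basis.piTensorProduct b).repr x₀ κ₀ = a := by
      show (∏ i, update (fun _ => (1 : ℚ_[p])) i₀ _ i) * _ = a
      rw [Finset.prod_update_of_mem (Finset.mem_univ i₀), Finset.prod_const_one, mul_one,
        inv_mul_cancel_right₀ hd0]
    have hmap := hA _ (map_mem_closure_congr p b _
      (fun i => rankOne_mem_closure_latticeAut p (b i) (κ₀ i) (κ' i) (ht i)))
    rwa [map_smul, map_rankOne_apply, hprod, smul_smul] at hmap
  -- conclusion: `c • w = Σ_κ (c * w_κ) • B_κ`
  rintro _ ⟨w, hw, rfl⟩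
  have hw' : c • w = ∑ κ', (c * (Basis.piTensorProduct b).repr w κ') • Basis.piTensorProduct b κ' := by
    conv_lhs => rw [← (Basis.piTensorProduct b).sum_repr w]
    rw [Finset.smul_sum]
    simp only [smul_smul]
  show c • w ∈ _
  rw [hw']
  exact AddSubgroup.sum_mem _ fun κ' _ => hBmem κ' _ ((mem_basisLattice p _).mp hw κ')

end Tensor

end PadicModule

end Literature.IUT.LogVolume

end
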